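import Summits.CriticalPhenomena.PercolationContinuityZ3.Theorems.PercNearOneGluingNoHeavyQuantFarTreeLevelBounds
import HarnessLib

/-!
# QUANT lane R8, FAR on trees: the Cantelli row for independent blobs one half-level above FAR
# (`EW > 2y − 3`, least gate `≤ 1/2`, all blocks of size `≤ y − 3` ⟹ `P(W ≥ y) ≥ g`)

builds on p205010 (kernel theorem, internal audit signed; external expert review pending)

Support file (`--supports stmt-CriticalPhenomena-4575`), QUANT lane seat prim-quant-census-1 (gen 11); memo
`run/shared/lean/prim/quant/prim-quant-census-1/B4-SLIVER-G11.md` §7–§8.  Theorems only; no sorries; standard axioms.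

After this session the single blob-sum statement still missing from a kernel proof of (B-4) (hence of `Quant.HubBlocksProfileIneq` along
PROFILE-PROOF-G10) is  **(U)** `y ≥ 3, EW > 2y − 3, least gate g ≤ 1/2 ⟹ P(W ≥ y) ≥ g`.  This file proves its small-block regime by Cantelli's
inequality (`Quant.bernoulliWeight_cantelli` with the exact first two moments of `…QuantIndepBlobMoments`):

* `Quant.IndepBlob.tail_ge_gate_of_cantelli` — for ANY gates: if `y − 1 < EW` and `p y₀ · Σ a_k² p_k(1−p_k) ≤ (1 − p y₀)·(EW − (y−1))²` then
  `p y₀ ≤ P(y ≤ W)`.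
* `Quant.IndepBlob.tail_ge_gate_of_small_blocks` — gates `p y₀ ≤ p k` with `p y₀ ≤ 1/2`, sizes `a k ≤ y − 3`, and `2y − 3 < EW` ⟹ `p y₀ ≤ P(y ≤ W)`
  (the variance is `≤ a_max (1 − g) EW ≤ (y−3)(1−g)EW`, and `g (y−3) EW ≤ (EW − y + 1)²` for `g ≤ 1/2`, `EW > 2y − 3`).
The complementary regime of (U) (a block of size `≥ y − 2`) is certified instance-wise by one conditioning step (memo §8) and is open as a theorem.
[this work]
-/

namespace Summit.CriticalPhenomena.PercolationContinuityZ3.Theorems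

namespace Quant

namespace IndepBlob

open Finset

variable {κ : Type*} [Fintype κ] [DecidableEq κ]

/-- **Cantelli row.**  Gates `0 ≤ p k ≤ 1`, integer sizes, a blob `y₀`, a level `y` with `y − 1 < EW = Σ a_k p_k`.  If
`p y₀ · V ≤ (1 − p y₀) · (EW − (y − 1))²` with `V = Σ a_k² p_k (1 − p_k)` the variance of `W`, then `p y₀ ≤ P(y ≤ W)`. [this work] -/
theorem tail_ge_gate_of_cantelli (p : κ → ℝ) (a : κ → ℕ) (hp0 : ∀ k, 0 ≤ p k) (hp1 : ∀ k, p k ≤ 1) (y₀ : κ) (y : ℕ)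
    (hD : (y : ℝ) - 1 < ∑ k, (a k : ℝ) * p k)
    (hV : p y₀ * ∑ k, (a k : ℝ) ^ 2 * p k * (1 - p k) ≤ (1 - p y₀) * (∑ k, (a k : ℝ) * p k - ((y : ℝ) - 1)) ^ 2) :
    p y₀ ≤ ∑ s ∈ (Finset.univ : Finset (Finset κ)).filter (fun s => y ≤ ∑ k ∈ s, a k), (∏ k, if k ∈ s then p k else 1 - p k) := by
  set m : ℝ := ∑ k, (a k : ℝ) * p k with hm
  set V : ℝ := ∑ k, (a k : ℝ) ^ 2 * p k * (1 - p k) with hVdef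
  set D : ℝ := m - ((y : ℝ) - 1) with hDdef
  have hDpos : 0 < D := by rw [hDdef]; linarith
  have hg0 : 0 ≤ p y₀ := hp0 y₀
  have hV0 : 0 ≤ V := by
    rw [hVdef]
    refine Finset.sum_nonneg fun k _ => ?_
    have := hp0 k; have := hp1 k
    have : (0 : ℝ) ≤ (a k : ℝ) ^ 2 := by positivity
    have : 0 ≤ p k * (1 - p k) := mul_nonneg (hp0 k) (by linarith [hp1 k])
    nlinarith
  -- the first two moments of `X = Σ_{k ∈ s} a k`
  have hmean : ∑ s : Finset κ, (∏ k, if k ∈ s then p k else 1 - p k) * (∑ k ∈ s, (a k : ℝ)) = m :=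
    sum_bernoulliWeight_mul_count p (fun k => (a k : ℝ))
  have hvar : ∑ s : Finset κ, (∏ k, if k ∈ s then p k else 1 - p k) * ((∑ k ∈ s, (a k : ℝ)) - m) ^ 2 = V := by
    have h2 := sum_bernoulliWeight_mul_sq_sub p (fun k => (a k : ℝ)) m
    have e : ∀ s : Finset κ, ((∑ k ∈ s, (a k : ℝ)) - m) ^ 2 = (m - ∑ k ∈ s, (a k : ℝ)) ^ 2 := fun s => by ring
    simp_rw [e]
    rw [h2, ← hm, sub_self, zero_pow two_ne_zero, zero_add]
  -- Cantelli at `j = y − 1`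
  have hcant := bernoulliWeight_cantelli p hp0 hp1 (fun s => ∑ k ∈ s, (a k : ℝ)) m V ((y : ℝ) - 1) hmean hvar (by linarith)
  -- `V/(V + D²) ≤ 1 − g`
  have hden : 0 < V + (m - ((y : ℝ) - 1)) ^ 2 := by positivity
  have hfrac : V / (V + (m - ((y : ℝ) - 1)) ^ 2) ≤ 1 - p y₀ := by
    rw [div_le_iff₀ hden, ← hDdef]
    nlinarith [hV, hV0, hg0]
  -- complement: `P(W ≤ y − 1) + P(y ≤ W) = 1`
  have hL : ∑ W ∈ (Finset.univ : Finset (Finset κ)).filter (fun W => (∑ k ∈ W, (a k : ℝ)) ≤ (y : ℝ) - 1),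
      (∏ k, if k ∈ W then p k else 1 - p k) =
      ∑ s ∈ (Finset.univ : Finset (Finset κ)).filter (fun s => ¬ (y ≤ ∑ k ∈ s, a k)), (∏ k, if k ∈ s then p k else 1 - p k) := by
    refine Finset.sum_congr (Finset.filter_congr fun s _ => ?_) fun _ _ => rfl
    rw [not_le]
    constructor
    · intro h
      have : ((∑ k ∈ s, a k : ℕ) : ℝ) + 1 ≤ (y : ℝ) := by push_cast; linarith
      have h' : ((∑ k ∈ s, a k + 1 : ℕ) : ℝ) ≤ ((y : ℕ) : ℝ) := by push_cast; linarith
      have h'' : ∑ k ∈ s, a k + 1 ≤ y := by exact_mod_cast h'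
      omega
    · intro h
      have h' : ∑ k ∈ s, a k + 1 ≤ y := by omega
      have : ((∑ k ∈ s, a k + 1 : ℕ) : ℝ) ≤ ((y : ℕ) : ℝ) := by exact_mod_cast h'
      push_cast at this
      linarith
  have hcompl := Finset.sum_filter_add_sum_filter_not (Finset.univ : Finset (Finset κ))
    (fun s => y ≤ ∑ k ∈ s, a k) (fun s => (∏ k, if k ∈ s then p k else 1 - p k))
  rw [sum_bernoulliWeight p] at hcompl
  rw [hL] at hcant
  linarith

/-- **Small blocks: FAR half a level up holds outright.**  Gates `0 ≤ p k ≤ 1` with least gate `p y₀ ≤ 1/2` (`p y₀ ≤ p k`), integer sizes with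
`a k ≤ y − 3` for every `k`, and `2y − 3 < EW`.  Then `p y₀ ≤ P(y ≤ W)` — lemma (U) of memo B4-SLIVER-G11 in the regime without big blocks. [this work] -/
theorem tail_ge_gate_of_small_blocks (p : κ → ℝ) (a : κ → ℕ) (hp0 : ∀ k, 0 ≤ p k) (hp1 : ∀ k, p k ≤ 1) (y₀ : κ) (hy₀ : ∀ k, p y₀ ≤ p k)
    (hhalf : p y₀ ≤ 1 / 2) (y : ℕ) (ha : ∀ k, a k + 3 ≤ y)
    (h : 2 * (y : ℝ) - 3 < ∑ k, (a k : ℝ) * p k) :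
    p y₀ ≤ ∑ s ∈ (Finset.univ : Finset (Finset κ)).filter (fun s => y ≤ ∑ k ∈ s, a k), (∏ k, if k ∈ s then p k else 1 - p k) := by
  set g : ℝ := p y₀ with hg
  set m : ℝ := ∑ k, (a k : ℝ) * p k with hm
  have hg0 : 0 ≤ g := hp0 y₀
  have hm0 : 0 ≤ m := Finset.sum_nonneg fun k _ => by have := hp0 k; positivity
  have hy3 : (3 : ℝ) ≤ y := by
    rcases isEmpty_or_nonempty κ with hκ | hκ
    · have : m = 0 := by rw [hm]; exact Finset.sum_eq_zero fun k _ => (hκ.false k).elim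
      -- then `2y − 3 < 0`, so `y ≤ 1`; but we still need `3 ≤ y`?  No: in that case the claim is `g ≤ P(...)` with `κ` empty and we argue directly below.
      -- To keep one proof path, derive `3 ≤ y` from a witness when `κ` is nonempty, else handle separately.
      exfalso
      -- with `κ` empty, `y₀ : κ` is a witness of nonemptiness
      exact hκ.false y₀
    · have := ha y₀
      have : (3 : ℝ) ≤ ((a y₀ + 3 : ℕ) : ℝ) := by exact_mod_cast (by omega : 3 ≤ a y₀ + 3)
      have h2 : ((a y₀ + 3 : ℕ) : ℝ) ≤ y := by exact_mod_cast ha y₀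
      linarith
  refine tail_ge_gate_of_cantelli p a hp0 hp1 y₀ y (by linarith) ?_
  -- variance bound: `V ≤ (y − 3)(1 − g) m`
  have hVle : ∑ k, (a k : ℝ) ^ 2 * p k * (1 - p k) ≤ ((y : ℝ) - 3) * (1 - g) * m := by
    rw [hm, Finset.mul_sum]
    refine Finset.sum_le_sum fun k _ => ?_
    have hak : (a k : ℝ) ≤ (y : ℝ) - 3 := by
      have : ((a k + 3 : ℕ) : ℝ) ≤ y := by exact_mod_cast ha k
      push_cast at this
      linarith
    have ha0 : (0 : ℝ) ≤ a k := by positivity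
    have hpk0 := hp0 k
    have hpk1 := hp1 k
    have hgk : g ≤ p k := hy₀ k
    -- `a² p (1−p) ≤ (y−3) · a · p · (1 − g)`
    have h1 : (a k : ℝ) ^ 2 * p k * (1 - p k) ≤ (a k : ℝ) * ((y : ℝ) - 3) * p k * (1 - p k) := by
      have : (a k : ℝ) ^ 2 ≤ (a k : ℝ) * ((y : ℝ) - 3) := by nlinarith
      have hpp : 0 ≤ p k * (1 - p k) := mul_nonneg hpk0 (by linarith)
      nlinarith
    have h2 : (a k : ℝ) * ((y : ℝ) - 3) * p k * (1 - p k) ≤ (a k : ℝ) * ((y : ℝ) - 3) * p k * (1 - g) := by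
      have : 0 ≤ (a k : ℝ) * ((y : ℝ) - 3) * p k := by
        have : (0 : ℝ) ≤ (y : ℝ) - 3 := by linarith
        positivity
      nlinarith
    nlinarith
  -- `g (y − 3)(1 − g) m ≤ (1 − g)(m − y + 1)²`: since `g ≤ 1/2`, `g (y − 3) m ≤ (m − y + 1)²` for `m > 2y − 3`
  have hkey : g * (((y : ℝ) - 3) * (1 - g) * m) ≤ (1 - g) * (m - ((y : ℝ) - 1)) ^ 2 := by
    have h1g : 0 ≤ 1 - g := by linarith
    -- reduce to `g (y−3) m ≤ (m − y + 1)²`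
    have hcore : g * ((y : ℝ) - 3) * m ≤ (m - ((y : ℝ) - 1)) ^ 2 := by
      -- `g (y−3) m ≤ (y−3) m / 2` and `(y−3) m ≤ 2 (m − y + 1)²` when `m ≥ 2y − 3`, `y ≥ 3`:
      -- indeed `2(m−y+1)² − (y−3)m` is increasing in `m` for `m ≥ 2y−3` and equals `2(y−2)² − (y−3)(2y−3) = y − 1 ≥ 0` at `m = 2y − 3`.
      have hA : g * ((y : ℝ) - 3) * m ≤ ((y : ℝ) - 3) * m / 2 := by
        have : 0 ≤ ((y : ℝ) - 3) * m := mul_nonneg (by linarith) hm0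
        nlinarith
      have hB : ((y : ℝ) - 3) * m ≤ 2 * (m - ((y : ℝ) - 1)) ^ 2 := by
        -- write `m = (2y − 3) + e`, `e > 0`
        have he : 0 < m - (2 * (y : ℝ) - 3) := by linarith
        nlinarith [mul_nonneg he.le (by linarith : (0 : ℝ) ≤ (y : ℝ) - 3), sq_nonneg (m - (2 * (y : ℝ) - 3))]
      linarith
    have := mul_le_mul_of_nonneg_left hcore h1g
    nlinarith
  calc g * ∑ k, (a k : ℝ) ^ 2 * p k * (1 - p k) ≤ g * (((y : ℝ) - 3) * (1 - g) * m) :=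
        mul_le_mul_of_nonneg_left hVle hg0
    _ ≤ (1 - g) * (m - ((y : ℝ) - 1)) ^ 2 := hkey
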